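import Mathlib
import HarnessLib
import Summits.NavierStokesRegularity.NavierStokesRegularity.Theorems.PoloidalWindowDoorLrcModEntireSheetTransport

/-!
# Route `PoloidalWindowDoor`, item `LrcModEntire` (stmt-NavierStokesRegularity-20428), cell (Q4-sonic) of the (TH) column —
# THE TRANSPORT LAW ON A CHARACTERISTIC SHEET, GENERAL LOWER-ORDER TERMS (for the CURVED branch in Fermi–shear coordinates)

Cell ns-regularity-ideate, LEAD-lineage seat ns-poloidal-K2-p3 g16 (`--supports stmt-NavierStokesRegularity-20428`; memo `Cruxes/LrcModEntire/T2B-g16-sonic.md` v2 §5).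
Class-free `pd`-calculus (`…SheetCauchyUniqueness`).  A smooth `H` on the slab `{z ∈ I}` solving
`∂_z²H + A(z)∂_z∂_nH + B(z)∂_nH + Q(z)∂_n²H + μ(z)·(c₁∂_s²H + c₂∂_sH + c₃∂_nH) = 0`
with arbitrary smooth coefficients `c₁, c₂, c₃` of `(s,n,z)` in the horizontal bracket (in Fermi–shear coordinates over a curved branch of curvature `k(s)`:
`c₁ = J⁻²`, `c₂ = (n + d)k′J⁻³`, `c₃ = −k/J`, `J = 1 − (n + d(z))k(s)`), a CHARACTERISTIC sheet `Q ≡ 0` on `I`, and DOUBLE sheet data `∂_nH = ∂_sH = 0` on `{n = 0}`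
(the web points are critical in both horizontal directions) obeys, on the sheet, the TRANSPORT LAW
`A(z)·∂_z a + (B(z) + μ(z)c₃(s,0,z))·a = 0` for `a(s,z) = ∂_n²H(s,0,z)`:

* `transport_on_characteristic_sheet_gen` — the law above (with `k ≡ 0`, i.e. `c₃ = 0`, it is the core of `…SheetTransport`);
* `hasDerivAt_curved_transport` — for `A = −2d′`, `B = −d″`, `μ = −d′²` (characteristic) and `c₃(s,0,z) = −k(s)/(1 − d(z)k(s))`:
  `z ↦ (1 − d(z)k(s))·d′(z)·a(s,z)²` has derivative `0`.

WHAT THIS IS NOT: not a claim about Navier–Stokes regularity; calculus (bears_on LADDER-NS N0 via item 20428; consumer: the cell's `…Q4SonicCurvedFlat`).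
-/

noncomputable section

set_option linter.dupNamespace false
set_option linter.unusedVariables false

namespace Summit.NavierStokesRegularity.NavierStokesRegularity.Theorems.PoloidalWindowDoorLrcModEntireSheetTransportGen

open Set Function Filter Topology Metric
open scoped ContDiff
open Summit.NavierStokesRegularity.NavierStokesRegularity.Theorems.PoloidalWindowDoorLrcModEntireSheetCauchyUniqueness
open Summit.NavierStokesRegularity.NavierStokesRegularity.Theorems.PoloidalWindowDoorLrcModEntireSheetTransport

/-- Product rule for `pd` with a general smooth coefficient. -/
theorem pd_mul {I : Set ℝ} (hI : IsOpen I) {c K : ℝ × ℝ × ℝ → ℝ} (hc : ContDiffOn ℝ ∞ c (slab I)) (hK : ContDiffOn ℝ ∞ K (slab I))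
    (v : ℝ × ℝ × ℝ) {p : ℝ × ℝ × ℝ} (hp : p ∈ slab I) :
    pd v (fun q => c q * K q) p = pd v c p * K p + c p * pd v K p := by
  unfold pd
  rw [fderiv_fun_mul (differentiableAt_of_slab hI hc hp) (differentiableAt_of_slab hI hK hp)]
  simp only [_root_.add_apply, _root_.smul_apply, smul_eq_mul]
  ring

/-- **THE TRANSPORT LAW ON A CHARACTERISTIC SHEET, general horizontal lower-order terms.** -/
theorem transport_on_characteristic_sheet_gen {I : Set ℝ} (hI : IsOpen I) {A B Q μ : ℝ → ℝ}
    (hA : ∀ z ∈ I, DifferentiableAt ℝ A z) (hB : ∀ z ∈ I, DifferentiableAt ℝ B z)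
    (hQ : ∀ z ∈ I, DifferentiableAt ℝ Q z) (hμ : ∀ z ∈ I, DifferentiableAt ℝ μ z)
    {c₁ c₂ c₃ : ℝ × ℝ × ℝ → ℝ} (hc₁ : ContDiffOn ℝ ∞ c₁ (slab I)) (hc₂ : ContDiffOn ℝ ∞ c₂ (slab I)) (hc₃ : ContDiffOn ℝ ∞ c₃ (slab I))
    {H : ℝ × ℝ × ℝ → ℝ} (hH : ContDiffOn ℝ ∞ H (slab I))
    (hpde : ∀ p ∈ slab I, pd eZ (pd eZ H) p + A p.2.2 * pd eZ (pd eN H) p + B p.2.2 * pd eN H p + Q p.2.2 * pd eN (pd eN H) p +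
      μ p.2.2 * (c₁ p * pd eS (pd eS H) p + c₂ p * pd eS H p + c₃ p * pd eN H p) = 0)
    (hQ0 : ∀ z ∈ I, Q z = 0) (hN : ∀ s : ℝ, ∀ z ∈ I, pd eN H (s, 0, z) = 0) (hS : ∀ s : ℝ, ∀ z ∈ I, pd eS H (s, 0, z) = 0)
    (s : ℝ) {z : ℝ} (hz : z ∈ I) :
    A z * pd eZ (pd eN (pd eN H)) (s, 0, z) + (B z + μ z * c₃ (s, 0, z)) * pd eN (pd eN H) (s, 0, z) = 0 := by
  set p : ℝ × ℝ × ℝ := (s, 0, z) with hpdef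
  have hp : p ∈ slab I := hz
  have hN0 : eN.2.2 = 0 := rfl
  -- smoothness of all the pieces
  have hZ := contDiffOn_pd hI hH eZ
  have hNs := contDiffOn_pd hI hH eN
  have hSs := contDiffOn_pd hI hH eS
  have hZZ := contDiffOn_pd hI hZ eZ
  have hZN := contDiffOn_pd hI hNs eZ
  have hNN := contDiffOn_pd hI hNs eN
  have hSS := contDiffOn_pd hI hSs eS
  have hbr : ContDiffOn ℝ ∞ (fun q => c₁ q * pd eS (pd eS H) q + c₂ q * pd eS H q + c₃ q * pd eN H q) (slab I) :=
    ((hc₁.mul hSS).add (hc₂.mul hSs)).add (hc₃.mul hNs)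
  -- `∂_n (P H) = 0` at `p`
  set Φ : ℝ × ℝ × ℝ → ℝ := fun q => pd eZ (pd eZ H) q + A q.2.2 * pd eZ (pd eN H) q + B q.2.2 * pd eN H q +
    Q q.2.2 * pd eN (pd eN H) q + μ q.2.2 * (c₁ q * pd eS (pd eS H) q + c₂ q * pd eS H q + c₃ q * pd eN H q) with hΦ
  have hzero : pd eN Φ p = 0 := by
    have h : Φ =ᶠ[𝓝 p] fun _ => 0 :=
      Filter.eventuallyEq_of_mem ((isOpen_slab hI).mem_nhds hp) fun q hq => hpde q hq
    rw [pd_congr_of_eventuallyEq eN h]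
    simp [pd]
  -- expand term by term
  have hcoef : ∀ {c : ℝ → ℝ}, (∀ z ∈ I, DifferentiableAt ℝ c z) → ∀ {K : ℝ × ℝ × ℝ → ℝ}, ContDiffOn ℝ ∞ K (slab I) →
      DifferentiableAt ℝ (fun q : ℝ × ℝ × ℝ => c q.2.2 * K q) p := by
    intro c hc K hK
    have hproj : DifferentiableAt ℝ (fun q : ℝ × ℝ × ℝ => q.2.2) p := differentiableAt_snd.comp _ differentiableAt_snd
    exact ((hc p.2.2 hp).comp p hproj).mul (differentiableAt_of_slab hI hK hp)
  have hd1 : DifferentiableAt ℝ (pd eZ (pd eZ H)) p := differentiableAt_of_slab hI hZZ hp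
  have hd2 := hcoef hA hZN
  have hd3 := hcoef hB hNs
  have hd4 := hcoef hQ hNN
  have hd5 := hcoef hμ hbr
  have hsum : pd eN Φ p =
      pd eN (pd eZ (pd eZ H)) p + pd eN (fun q : ℝ × ℝ × ℝ => A q.2.2 * pd eZ (pd eN H) q) p +
        pd eN (fun q : ℝ × ℝ × ℝ => B q.2.2 * pd eN H q) p + pd eN (fun q : ℝ × ℝ × ℝ => Q q.2.2 * pd eN (pd eN H) q) p +
        pd eN (fun q : ℝ × ℝ × ℝ => μ q.2.2 * (c₁ q * pd eS (pd eS H) q + c₂ q * pd eS H q + c₃ q * pd eN H q)) p := by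
    have hF : HasFDerivAt Φ
        (fderiv ℝ (pd eZ (pd eZ H)) p + fderiv ℝ (fun q : ℝ × ℝ × ℝ => A q.2.2 * pd eZ (pd eN H) q) p +
          fderiv ℝ (fun q : ℝ × ℝ × ℝ => B q.2.2 * pd eN H q) p +
          fderiv ℝ (fun q : ℝ × ℝ × ℝ => Q q.2.2 * pd eN (pd eN H) q) p +
          fderiv ℝ (fun q : ℝ × ℝ × ℝ => μ q.2.2 * (c₁ q * pd eS (pd eS H) q + c₂ q * pd eS H q + c₃ q * pd eN H q)) p) p :=
      (((hd1.hasFDerivAt.add hd2.hasFDerivAt).add hd3.hasFDerivAt).add hd4.hasFDerivAt).add hd5.hasFDerivAt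
    unfold pd
    rw [hF.fderiv]
    simp only [_root_.add_apply]
    rfl
  rw [hsum, pd_heightFun_mul hI hA hZN hN0 hp, pd_heightFun_mul hI hB hNs hN0 hp, pd_heightFun_mul hI hQ hNN hN0 hp,
    pd_heightFun_mul hI hμ hbr hN0 hp] at hzero
  -- the bracket: `∂_n (c₁ H_ss + c₂ H_s + c₃ H_n) = c₃ ∂_n∂_n H` on the sheet
  have hbr' : pd eN (fun q => c₁ q * pd eS (pd eS H) q + c₂ q * pd eS H q + c₃ q * pd eN H q) p =
      c₃ p * pd eN (pd eN H) p := by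
    have e1 : pd eN (fun q => c₁ q * pd eS (pd eS H) q + c₂ q * pd eS H q + c₃ q * pd eN H q) p =
        pd eN (fun q => c₁ q * pd eS (pd eS H) q) p + pd eN (fun q => c₂ q * pd eS H q) p + pd eN (fun q => c₃ q * pd eN H q) p := by
      have g1 : DifferentiableAt ℝ (fun q => c₁ q * pd eS (pd eS H) q) p := differentiableAt_of_slab hI (hc₁.mul hSS) hp
      have g2 : DifferentiableAt ℝ (fun q => c₂ q * pd eS H q) p := differentiableAt_of_slab hI (hc₂.mul hSs) hp
      have g3 : DifferentiableAt ℝ (fun q => c₃ q * pd eN H q) p := differentiableAt_of_slab hI (hc₃.mul hNs) hp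
      have hF2 : HasFDerivAt (fun q => c₁ q * pd eS (pd eS H) q + c₂ q * pd eS H q + c₃ q * pd eN H q)
          (fderiv ℝ (fun q => c₁ q * pd eS (pd eS H) q) p + fderiv ℝ (fun q => c₂ q * pd eS H q) p +
            fderiv ℝ (fun q => c₃ q * pd eN H q) p) p :=
        (g1.hasFDerivAt.add g2.hasFDerivAt).add g3.hasFDerivAt
      unfold pd at hF2 ⊢
      rw [hF2.fderiv]
      simp only [_root_.add_apply]
    rw [e1, pd_mul hI hc₁ hSS eN hp, pd_mul hI hc₂ hSs eN hp, pd_mul hI hc₃ hNs eN hp]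
    -- sheet data: `H_s = H_n = 0` on the sheet and their tangential derivatives
    have hS0 : pd eS H p = 0 := hS s z hz
    have hN0' : pd eN H p = 0 := hN s z hz
    have hSS0 : pd eS (pd eS H) p = 0 :=
      pd_eq_zero_of_vanish_on_sheet hI hS hz (differentiableAt_of_slab hI hSs hp) (v := eS) rfl
    have hNS0 : pd eN (pd eS H) p = 0 := by
      rw [pd_comm hI hH eN eS hp]
      exact pd_eq_zero_of_vanish_on_sheet hI hN hz (differentiableAt_of_slab hI hNs hp) (v := eS) rfl
    have hNSS0 : pd eN (pd eS (pd eS H)) p = 0 := by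
      have c3 : pd eN (pd eS (pd eS H)) p = pd eS (pd eS (pd eN H)) p := by
        rw [pd_comm hI hSs eN eS hp]
        exact pd_congr_on_slab hI eS (fun q hq => pd_comm hI hH eN eS hq) hp
      rw [c3]
      have hSK : ∀ s' : ℝ, ∀ z' ∈ I, pd eS (pd eN H) (s', 0, z') = 0 := fun s' z' hz' =>
        pd_eq_zero_of_vanish_on_sheet hI hN hz' (differentiableAt_of_slab hI hNs (sheet_mem_slab s' hz')) (v := eS) rfl
      exact pd_eq_zero_of_vanish_on_sheet hI hSK hz (differentiableAt_of_slab hI (contDiffOn_pd hI hNs eS) hp) (v := eS) rfl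
    rw [hS0, hN0', hSS0, hNS0, hNSS0]
    ring
  -- commute `∂_n` past `∂_z∂_z` and `∂_z`; tangential vanishing of `∂_z∂_z∂_n H`
  have c1 : pd eN (pd eZ (pd eZ H)) p = 0 := by
    have e : pd eN (pd eZ (pd eZ H)) p = pd eZ (pd eZ (pd eN H)) p := by
      rw [pd_comm hI hZ eN eZ hp]
      exact pd_congr_on_slab hI eZ (fun q hq => pd_comm hI hH eN eZ hq) hp
    rw [e]
    have hZK : ∀ s' : ℝ, ∀ z' ∈ I, pd eZ (pd eN H) (s', 0, z') = 0 := fun s' z' hz' =>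
      pd_eq_zero_of_vanish_on_sheet hI hN hz' (differentiableAt_of_slab hI hNs (sheet_mem_slab s' hz')) (v := eZ) rfl
    exact pd_eq_zero_of_vanish_on_sheet hI hZK hz (differentiableAt_of_slab hI hZN hp) (v := eZ) rfl
  have c2 : pd eN (pd eZ (pd eN H)) p = pd eZ (pd eN (pd eN H)) p := pd_comm hI hNs eN eZ hp
  rw [c1, c2, hbr', hQ0 z hz] at hzero
  have hp22 : p.2.2 = z := rfl
  rw [hp22] at hzero
  linear_combination hzero

/-- **The curved transport law as a derivative:** for `A = −2d′`, `B = −d″`, `μ(z) = −d′(z)²` (characteristic sheet) and `c₃(s,0,z) = −k(s)/(1 − d(z)k(s))`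
with the Fermi factor `1 − d(z)k(s) ≠ 0`, the quantity `(1 − d(z)k(s))·d′(z)·a(s,z)²`, `a(s,z) = ∂_n²H(s,0,z)`, has `z`-derivative `0`. -/
theorem hasDerivAt_curved_transport {I : Set ℝ} (hI : IsOpen I) {d : ℝ → ℝ} (hd : ContDiffOn ℝ ∞ d I) {k : ℝ → ℝ}
    {H : ℝ × ℝ × ℝ → ℝ} (hH : ContDiffOn ℝ ∞ H (slab I)) (s : ℝ) {z : ℝ} (hz : z ∈ I) (hJ : 1 - d z * k s ≠ 0)
    (hlaw : (-2 * deriv d z) * pd eZ (pd eN (pd eN H)) (s, 0, z) +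
      (-(deriv (deriv d) z) + (-(deriv d z) ^ 2) * (-(k s) / (1 - d z * k s))) * pd eN (pd eN H) (s, 0, z) = 0) :
    HasDerivAt (fun z' : ℝ => (1 - d z' * k s) * deriv d z' * (pd eN (pd eN H) (s, 0, z') * pd eN (pd eN H) (s, 0, z'))) 0 z := by
  -- derivatives of `d`
  have hdz : DifferentiableAt ℝ d z := (hd.contDiffAt (hI.mem_nhds hz)).differentiableAt (by simp)
  have hd1 : ContDiffOn ℝ ∞ (deriv d) I := hd.deriv_of_isOpen hI (m := ∞) (by simp)
  have hd1z : DifferentiableAt ℝ (deriv d) z := (hd1.contDiffAt (hI.mem_nhds hz)).differentiableAt (by simp)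
  -- the derivative of `a` along the sheet
  have hNN := contDiffOn_pd hI (contDiffOn_pd hI hH eN) eN
  have ha : HasDerivAt (fun z' : ℝ => pd eN (pd eN H) (s, 0, z')) (pd eZ (pd eN (pd eN H)) (s, 0, z)) z :=
    hasDerivAt_sheet_line hI hNN s hz
  set a := pd eN (pd eN H) (s, 0, z) with ha_def
  set a' := pd eZ (pd eN (pd eN H)) (s, 0, z) with ha'_def
  have hJd : HasDerivAt (fun z' : ℝ => 1 - d z' * k s) (0 - deriv d z * k s) z :=
    (hasDerivAt_const z (1 : ℝ)).sub (hdz.hasDerivAt.mul_const (k s))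
  have hprod : HasDerivAt (fun z' : ℝ => (1 - d z' * k s) * deriv d z' * (pd eN (pd eN H) (s, 0, z') * pd eN (pd eN H) (s, 0, z')))
      (((0 - deriv d z * k s) * deriv d z + (1 - d z * k s) * deriv (deriv d) z) * (a * a) +
        (1 - d z * k s) * deriv d z * (a' * a + a * a')) z :=
    (hJd.mul hd1z.hasDerivAt).mul (ha.mul ha)
  refine hprod.congr_deriv ?_
  -- algebra: the transport law kills the derivative (clear the Fermi factor from the denominator first)
  have hdiv : (1 - d z * k s) * (-(deriv d z) ^ 2 * (-(k s) / (1 - d z * k s))) = deriv d z ^ 2 * k s := by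
    field_simp
  linear_combination (-(a) * (1 - d z * k s)) * hlaw + (a * a) * hdiv

end Summit.NavierStokesRegularity.NavierStokesRegularity.Theorems.PoloidalWindowDoorLrcModEntireSheetTransportGen

end
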